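import Summits.Ventures.YMGap.FlowData.TubeTransferOperator
import Literature.MathematicalPhysics.QuantumLattice.GaugeGroups
import HarnessLib

/-!
# Venture YMGap, track Y3 FLOW-DATA — FLUX SECTORS and the TORELON (electric-flux) ENERGY `E₁` of the tube
# transfer operator — DEFINITIONS (file 2/2; file 1/2 = `FlowData/TubeTransferOperator.lean`)

HONEST FRAMING: venture file of the cell `pub-ymgap` (QuantumFields programme), track Y3 (FLOW-DATA), the
D-item behind STRUCTURE.md §5 / Sunday item (12) (lead R237 (c)): it TYPES FLOW-PLAN.md observable O1
(`E₁ := ln(λ̂₀/λ̂₀^{(e₁)})`, the torelon / `ℤ₂`-flux energy per unit time) and its siblings O2/O3, for the tube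
transfer operator of file 1/2, by OPERATOR NORMS (no spectral theorem is needed to state them).  No number, no
claim about any row, nothing about `L → ∞`, the continuum, confinement or a mass gap.

* Abstract layer (any real normed space `H`, any family `C : (Fin k → ZMod 2) → (H →L[ℝ] H)`):
  `fluxSign e s = (−1)^{e·s}`; the SECTOR PROJECTION `fluxProjection C e = 2^{−k} Σ_s (−1)^{e·s} C s` (for a
  representation of `ℤ₂^k` by isometric involutions: the orthogonal projection onto
  `{ψ : C_{ê_μ} ψ = (−1)^{e_μ} ψ ∀ μ}` = 't Hooft's sector of electric flux `e`); `sectorNorm T C e = ‖T ∘ P_e‖`;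
  `fluxEnergy T C e = log ‖T‖ − log ‖T ∘ P_e‖`; `‖P_e‖ ≤ 1`, `‖T P_e‖ ≤ ‖T‖`, `fluxEnergy ≥ 0` when `T P_e ≠ 0`.
* Tube layer: `tubeFluxProjection z k L e`, `tubeSectorNorm ρ z J k L e`, **`tubeFluxEnergy ρ z J k L e`** and
  **`torelonEnergy ρ z J k L μ := tubeFluxEnergy … (Pi.single μ 1)`** — FLOW-PLAN O1: `λ̂₀ = max spec T̂ = ‖T̂‖`,
  `λ̂₀^{(e)}` = top of `T̂` on the flux sector `e` over ALL momenta / point-group labels `= ‖T̂ P_e‖` for the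
  POSITIVE operator `T̂` (reflection positivity; `k = 3`: tree theorem `isPositive_wilsonTorusTransferMatrix` with
  file 1's dictionary); `E₁` is a DIFFERENCE of logarithms of sector tops, hence identical for `T`, `T̂` and
  `P̂^{½}K̂P̂^{½}` (same non-zero spectrum, common scalar).
* **The cell's object** `su2TubeTransferOperator β k L`, `su2FluxEnergy β k L e`, **`su2TorelonEnergy β k L μ`**:
  `G = SU(2)`, `ρ` = fundamental, `z = −1` (`su2MinusOne`, central, an involution), `J = β/2` for the cell's
  Wilson coupling `β ≡ β_W` (plaquette weight `exp(β_W · ½ Tr U_p)`).  The finite-volume law «L-Y3-σ» of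
  STRUCTURE.md §2/§5 reads, in these terms, `su2TorelonEnergy β 2 L 0 < L · (−log u(β))` (slice `k = 2`, theory
  dimension three; `u = I₂/I₁`); it is NOT stated in this file (rule (5): the lead names the conjecture file).

References: G. 't Hooft, Nucl. Phys. B 153 (1979) 141 (electric / magnetic flux on the torus) [cite: tHooft1979Flux];
M. Lüscher, Commun. Math. Phys. 54 (1977) 283 [cite: Luscher1977]; I. Montvay, G. Münster (1994) §3.2.6
[cite: MontvayMunster1994, §3.2.6].
-/

noncomputable section

open scoped BigOperators ENNReal
open MeasureTheory Filter Function
open Literature.MathematicalPhysics.QuantumFieldTheory Literature.Analysis.OperatorTheory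
open Literature.MathematicalPhysics.QuantumLattice (fundamentalRep fundamentalRep_apply continuous_fundamentalRep
  fundamentalRep_mem_unitaryGroup)
open Literature.Barriers.QuantumFields (scalarCenter scalarCenter_mem_center)

namespace Summit.Ventures.YMGap.FlowData

/-! ### Abstract layer: sector projections, sector norms and flux energies for a family of symmetry operators -/

section Abstract

variable {H : Type*} [NormedAddCommGroup H] [NormedSpace ℝ H] {k : ℕ}

/-- The **sign character** `χ_e(s) = (−1)^{e·s}` of `ℤ₂^k` (`e` = flux label, `s` = twist label):
`∏_μ (−1 if e_μ = s_μ = 1, else 1)`. -/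
def fluxSign (e s : Fin k → ZMod 2) : ℝ :=
  ∏ μ : Fin k, if e μ = 1 ∧ s μ = 1 then (-1 : ℝ) else 1

/-- `|χ_e(s)| = 1`. [folklore] -/
theorem abs_fluxSign (e s : Fin k → ZMod 2) : |fluxSign e s| = 1 := by
  unfold fluxSign
  rw [Finset.abs_prod]
  refine Finset.prod_eq_one fun μ _ => ?_
  split_ifs <;> simp

/-- `χ_e(0) = 1` (no twist). [folklore] -/
theorem fluxSign_zero_right (e : Fin k → ZMod 2) : fluxSign e 0 = 1 := by
  unfold fluxSign
  refine Finset.prod_eq_one fun μ _ => ?_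
  simp

/-- `χ_0(s) = 1` (trivial flux). [folklore] -/
theorem fluxSign_zero_left (s : Fin k → ZMod 2) : fluxSign 0 s = 1 := by
  unfold fluxSign
  refine Finset.prod_eq_one fun μ _ => ?_
  simp

/-- The **flux-sector projection** attached to a family of symmetry operators `C s`, `s ∈ ℤ₂^k`:
`P_e = 2^{−k} Σ_s (−1)^{e·s} C s`.  When `s ↦ C s` is a representation of `ℤ₂^k` by isometric involutions
(`C 0 = 1`, `C (s + s') = C s ∘ C s'`), `P_e` is the (orthogonal) projection onto the joint eigenspace
`{ψ : C_{ê_μ} ψ = (−1)^{e_μ} ψ for every μ}` — 't Hooft's sector of electric flux `e`. [cite: tHooft1979Flux] -/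
def fluxProjection (C : (Fin k → ZMod 2) → H →L[ℝ] H) (e : Fin k → ZMod 2) : H →L[ℝ] H :=
  ((2 : ℝ) ^ k)⁻¹ • ∑ s : Fin k → ZMod 2, fluxSign e s • C s

/-- The **sector norm** `‖T ∘ P_e‖`: for a positive operator `T` commuting with the `C s` this is the top of the
spectrum of `T` restricted to the flux sector `e` (FLOW-PLAN O1's `λ̂₀^{(e)}`, over all momenta and point-group
labels). -/
def sectorNorm (T : H →L[ℝ] H) (C : (Fin k → ZMod 2) → H →L[ℝ] H) (e : Fin k → ZMod 2) : ℝ :=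
  ‖T.comp (fluxProjection C e)‖

/-- The **flux energy** of the sector `e`: `log ‖T‖ − log ‖T ∘ P_e‖` (FLOW-PLAN O1/O2/O3:
`E_e := ln(λ̂₀/λ̂₀^{(e)})`; junk value when `T ∘ P_e = 0`). -/
def fluxEnergy (T : H →L[ℝ] H) (C : (Fin k → ZMod 2) → H →L[ℝ] H) (e : Fin k → ZMod 2) : ℝ :=
  Real.log ‖T‖ - Real.log (sectorNorm T C e)

/-- `‖P_e‖ ≤ 1` as soon as every `‖C s‖ ≤ 1` (triangle inequality over the `2^k` terms). [folklore] -/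
theorem norm_fluxProjection_le_one {C : (Fin k → ZMod 2) → H →L[ℝ] H} (hC : ∀ s, ‖C s‖ ≤ 1)
    (e : Fin k → ZMod 2) : ‖fluxProjection C e‖ ≤ 1 := by
  unfold fluxProjection
  have h2k : (0 : ℝ) < (2 : ℝ) ^ k := by positivity
  rw [norm_smul, norm_inv, Real.norm_of_nonneg h2k.le]
  have hsum : ‖∑ s : Fin k → ZMod 2, fluxSign e s • C s‖ ≤ (2 : ℝ) ^ k := by
    calc ‖∑ s : Fin k → ZMod 2, fluxSign e s • C s‖
        ≤ ∑ s : Fin k → ZMod 2, ‖fluxSign e s • C s‖ := norm_sum_le _ _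
      _ ≤ ∑ _s : Fin k → ZMod 2, (1 : ℝ) := Finset.sum_le_sum fun s _ => by
          rw [norm_smul, Real.norm_eq_abs, abs_fluxSign, one_mul]; exact hC s
      _ = (2 : ℝ) ^ k := by simp [Finset.card_univ, ZMod.card]
  calc ((2 : ℝ) ^ k)⁻¹ * ‖∑ s : Fin k → ZMod 2, fluxSign e s • C s‖
      ≤ ((2 : ℝ) ^ k)⁻¹ * (2 : ℝ) ^ k := mul_le_mul_of_nonneg_left hsum (inv_nonneg.2 h2k.le)
    _ = 1 := inv_mul_cancel₀ h2k.ne'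

/-- `‖T ∘ P_e‖ ≤ ‖T‖` (when every `‖C s‖ ≤ 1`). [folklore] -/
theorem sectorNorm_le_norm {C : (Fin k → ZMod 2) → H →L[ℝ] H} (hC : ∀ s, ‖C s‖ ≤ 1) (T : H →L[ℝ] H)
    (e : Fin k → ZMod 2) : sectorNorm T C e ≤ ‖T‖ := by
  unfold sectorNorm
  calc ‖T.comp (fluxProjection C e)‖ ≤ ‖T‖ * ‖fluxProjection C e‖ := ContinuousLinearMap.opNorm_comp_le _ _
    _ ≤ ‖T‖ * 1 := mul_le_mul_of_nonneg_left (norm_fluxProjection_le_one hC e) (norm_nonneg _)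
    _ = ‖T‖ := mul_one _

/-- `0 ≤ sectorNorm`. [folklore] -/
theorem sectorNorm_nonneg (T : H →L[ℝ] H) (C : (Fin k → ZMod 2) → H →L[ℝ] H) (e : Fin k → ZMod 2) :
    0 ≤ sectorNorm T C e := norm_nonneg _

/-- **Flux energies are non-negative** whenever the sector is not annihilated (`0 < ‖T ∘ P_e‖`) and every
`‖C s‖ ≤ 1`: `E_e = log ‖T‖ − log ‖T P_e‖ ≥ 0`. [folklore] -/
theorem fluxEnergy_nonneg {C : (Fin k → ZMod 2) → H →L[ℝ] H} (hC : ∀ s, ‖C s‖ ≤ 1) (T : H →L[ℝ] H)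
    (e : Fin k → ZMod 2) (hpos : 0 < sectorNorm T C e) : 0 ≤ fluxEnergy T C e := by
  unfold fluxEnergy
  exact sub_nonneg.2 (Real.log_le_log hpos (sectorNorm_le_norm hC T e))

/-- In the trivial family `C s = 1` (no symmetry used) the flux-`0` projection is the identity:
`P_0 = 2^{−k} Σ_s 1 = 1`. [folklore] -/
theorem fluxProjection_const_one_zero : fluxProjection (fun _ : Fin k → ZMod 2 => (1 : H →L[ℝ] H)) 0 = 1 := by
  unfold fluxProjection
  simp only [fluxSign_zero_left, one_smul, Finset.sum_const, Finset.card_univ, Fintype.card_fun, ZMod.card,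
    Fintype.card_fin]
  rw [← Nat.cast_smul_eq_nsmul ℝ, smul_smul]
  have h2k : (2 : ℝ) ^ k ≠ 0 := by positivity
  rw [Nat.cast_pow, Nat.cast_ofNat, inv_mul_cancel₀ h2k, one_smul]

end Abstract

/-! ### Sector projections and flux energies of the tube -/

section Tube

variable {G : Type*} [Group G] [TopologicalSpace G] [IsTopologicalGroup G] [CompactSpace G]
  [MeasurableSpace G] [BorelSpace G] {n : ℕ} (ρ : G →* Matrix (Fin n) (Fin n) ℂ) (z : G) (J : ℝ) (k L : ℕ)
  [NeZero L]

/-- The **flux-sector projection of the tube**, `P_e = 2^{−k} Σ_s (−1)^{e·s} C_s` on `L²(sliceMeasure)`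
(FLOW-PLAN §1.3: `e ∈ ℤ₂^k` the centre electric flux). [cite: tHooft1979Flux] -/
def tubeFluxProjection (e : Fin k → ZMod 2) :
    Lp ℝ 2 (sliceMeasure G k L) →L[ℝ] Lp ℝ 2 (sliceMeasure G k L) :=
  fluxProjection (fluxTwistOp k L z) e

/-- The **sector norm of the tube** `‖T ∘ P_e‖` (FLOW-PLAN O1: `λ̂₀^{(e)}`, up to the common normalisation). -/
def tubeSectorNorm (e : Fin k → ZMod 2) : ℝ :=
  sectorNorm (tubeTransferOperator ρ J k L) (fluxTwistOp k L z) e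

/-- **The flux energy of the tube** in the sector `e`: `E_e = log ‖T‖ − log ‖T ∘ P_e‖`
(FLOW-PLAN O1–O3: `E₁`, `E₂`, `E₃` for `e = (1,0,…)`, `(1,1,0,…)`, `(1,1,1)`). -/
def tubeFluxEnergy (e : Fin k → ZMod 2) : ℝ :=
  fluxEnergy (tubeTransferOperator ρ J k L) (fluxTwistOp k L z) e

/-- **The torelon energy** `E₁` along the axis `μ`: the flux energy of one unit of centre electric flux along `μ`
(`e = ê_μ`), i.e. `ln(λ̂₀/λ̂₀^{(ê_μ)})` — the energy per unit time of a `z`-flux line winding once around the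
`μ`-cycle of the spatial torus (FLOW-PLAN O1). -/
def torelonEnergy (μ : Fin k) : ℝ :=
  tubeFluxEnergy ρ z J k L (Pi.single μ 1)

/-- `‖P_e‖ ≤ 1` for the tube. [folklore] -/
theorem norm_tubeFluxProjection_le_one (e : Fin k → ZMod 2) : ‖tubeFluxProjection z k L e‖ ≤ 1 :=
  norm_fluxProjection_le_one (fun s => norm_fluxTwistOp_le_one (L := L) z s) e

/-- `‖T ∘ P_e‖ ≤ ‖T‖` for the tube: no sector lies above the vacuum. [folklore] -/
theorem tubeSectorNorm_le_norm (e : Fin k → ZMod 2) :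
    tubeSectorNorm ρ z J k L e ≤ ‖tubeTransferOperator ρ J k L‖ :=
  sectorNorm_le_norm (fun s => norm_fluxTwistOp_le_one (L := L) z s) _ e

/-- **`E_e ≥ 0`** whenever the sector is not annihilated by `T`. [folklore] -/
theorem tubeFluxEnergy_nonneg (e : Fin k → ZMod 2) (hpos : 0 < tubeSectorNorm ρ z J k L e) :
    0 ≤ tubeFluxEnergy ρ z J k L e :=
  fluxEnergy_nonneg (fun s => norm_fluxTwistOp_le_one (L := L) z s) _ e hpos

end Tube

/-! ### The cell's object: `SU(2)`, fundamental representation, `z = −1`, Wilson coupling `β_W` -/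

section SU2

/-- `−1 ∈ SU(2)`, the non-trivial central element, as the tree's `scalarCenter 2 (−1)`. [folklore] -/
def su2MinusOne : Matrix.specialUnitaryGroup (Fin 2) ℂ :=
  scalarCenter 2 (-1) (by norm_num) (by norm_num)

/-- `su2MinusOne` is the matrix `−1`. [folklore] -/
@[simp] theorem coe_su2MinusOne : ((su2MinusOne : Matrix.specialUnitaryGroup (Fin 2) ℂ) :
    Matrix (Fin 2) (Fin 2) ℂ) = -1 := by
  change (-1 : ℂ) • (1 : Matrix (Fin 2) (Fin 2) ℂ) = -1
  rw [neg_smul, one_smul]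

/-- `−1` is central in `SU(2)`. [folklore] -/
theorem su2MinusOne_mem_center : su2MinusOne ∈ Subgroup.center (Matrix.specialUnitaryGroup (Fin 2) ℂ) :=
  scalarCenter_mem_center 2 (-1) _ _

/-- `(−1)² = 1` in `SU(2)`: the twist by `su2MinusOne` is an involution. [folklore] -/
theorem su2MinusOne_mul_self : su2MinusOne * su2MinusOne = 1 := by
  apply Subtype.ext
  change ((su2MinusOne : Matrix.specialUnitaryGroup (Fin 2) ℂ) : Matrix (Fin 2) (Fin 2) ℂ) *
      ((su2MinusOne : Matrix.specialUnitaryGroup (Fin 2) ℂ) : Matrix (Fin 2) (Fin 2) ℂ) = 1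
  rw [coe_su2MinusOne, neg_mul_neg, one_mul]

/-- **The cell's tube transfer operator**: `SU(2)`, fundamental representation, Wilson coupling `β ≡ β_W`
(plaquette weight `exp(β_W · ½ Tr U_p) = exp((β_W/2) · Re tr U_p)`, hence `J = β_W/2`), slice dimension `k`
(`d = k + 1`), cross-section `(ℤ/L)^k`. -/
def su2TubeTransferOperator (β : ℝ) (k L : ℕ) [NeZero L] :
    Lp ℝ 2 (sliceMeasure (Matrix.specialUnitaryGroup (Fin 2) ℂ) k L) →L[ℝ]
      Lp ℝ 2 (sliceMeasure (Matrix.specialUnitaryGroup (Fin 2) ℂ) k L) :=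
  tubeTransferOperator (fundamentalRep (Fin 2)) (β / 2) k L

/-- **The cell's flux energies** `E_e(β_W; (ℤ/L)^k)`, `e ∈ ℤ₂^k` (FLOW-PLAN O1–O3 with `z = −1`). -/
def su2FluxEnergy (β : ℝ) (k L : ℕ) [NeZero L] (e : Fin k → ZMod 2) : ℝ :=
  tubeFluxEnergy (fundamentalRep (Fin 2)) su2MinusOne (β / 2) k L e

/-- **The cell's torelon energy** `E₁(β_W; (ℤ/L)^k)` along the axis `μ` (FLOW-PLAN O1; by the symmetry of the cube
all axes give the same number, not claimed here). -/
def su2TorelonEnergy (β : ℝ) (k L : ℕ) [NeZero L] (μ : Fin k) : ℝ :=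
  torelonEnergy (fundamentalRep (Fin 2)) su2MinusOne (β / 2) k L μ

/-- `su2TorelonEnergy` unfolds to the flux energy of `ê_μ`. [folklore] -/
theorem su2TorelonEnergy_eq (β : ℝ) (k L : ℕ) [NeZero L] (μ : Fin k) :
    su2TorelonEnergy β k L μ = su2FluxEnergy β k L (Pi.single μ 1) := rfl

end SU2

end Summit.Ventures.YMGap.FlowData
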